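import Summits.Ventures.CertifiedManyBodySolver.Downfold.EmeryHybridisationShapeLever
import HarnessLib

/-!
# THE `t_pp′` LEVER OF THE FERMI-SURFACE SHAPE AT FIXED DOPING — CONDITIONAL: on the cuprate side of the doping discriminant a larger indirect
# oxygen hopping `t_pp′` makes the one-band `t′/t` MORE negative; the fixed-energy `t_pp′` comparison without strict hypotheses; a slab bound that
# certifies the discriminant's sign on a `t_pp′`-segment

Venture CertifiedManyBodySolver, cell `pub/hubbard-downfold` (stage S1; INFLATION-RULES-3to1-B §B.85 (m)–(p)), seat hubbard-downfold-mod-4 (technique B = band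
level, g35); namespace `Summit.Ventures.CertifiedManyBodySolver.Downfold.Emery`. Everything PROVED (0 sorry, no definition). WHAT THIS IS NOT: a statement
about any material; `U = 0` one-body kinematics of the σ (d–p_x–p_y + t_pp, t_pp′) model; no number lives here.

Of the four one-body directions of the fixed-doping shape `R(θ) = fsRatio(θ; ε_F(θ; ν))`, three are signed WITHOUT hypothesis beyond the sheet regime
(`Δ ↑ ⇒ R ↑` §B.83 (g); `t_pd ↑ ⇒ R ↑` §B.85 (e); oxygen ray `↑ ⇒ R ↓` §B.85 (h)). The fourth, `t_pp′` alone, has two channels: at FIXED energy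
`fsRatio` decreases with `t_pp′` (`fsRatio_anti_tppP_at` below, the `≤`-regime form of `EmeryFermiSurfaceRatioWindow.fsRatio_anti_c`), and `ε_F`
decreases with `t_pp′` (`fermiEnergyOf_anti_tppP`, §B.83 (h)); the energy channel has the sign of the DOPING DISCRIMINANT (`EmeryFermiSurfaceDoping`):
on the cuprate side (`dopingDisc ≤ 0`: `t′/t` increases with the energy) both channels agree.

* §1 `fsRatio_anti_tppP_at`: at a common energy `E ≥ 0` with `t_pp′E ≤ t_pd²` (non-strict sheet regime), `0 ≤ c ≤ c′ ≤ t_pp`: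
  `fsRatio(c′; E) ≤ fsRatio(c; E)` (`N` non-decreasing, `D` non-increasing in `t_pp′` in the regime; cross-product form).
* §2 **THE CONDITIONAL `t_pp′` LEVER** (`fsRatio_fermiEnergyOf_anti_tppP_of_dopingDisc`): for `γ ≥ 0`, `c + γ ≤ t_pp`, regime `(c + γ)·ε_F(c; ν) ≤ t_pd²` and
  **`dopingDisc(Δ, t_pd, t_pp, c + γ; ε_F(c + γ), ε_F(c)) ≤ 0`**: `R(c + γ) ≤ R(c)`. Corner form (`…_of_corners`): it suffices that `dopingDisc ≤ 0` at the four
  corners of a bracket `[e₁, e₂] ∋ ε_F(c + γ), ε_F(c)` (bilinearity, `dopingDisc_nonpos_of_corners`) — what a pair of `pointBracketCheck`s delivers.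
* §3 **THE SLAB BOUND** (`dopingDisc_le_slabBound`, `dopingDisc_nonpos_on_slab`): for `c ∈ [c₁, c₂]` (`0 ≤ c₁`, `c₂ ≤ t_pp`, `c₂Δ ≤ t_pd²`) and energies
  `e₁, e₂ ∈ [0, e]`: `dopingDisc ≤ t_pd²·[t_pp²Δ − 2(c₁ + t_pp)(t_pd² − c₂Δ) + 4c₂(c₂ + t_pp)e] + c₂t_pp²e²` — ONE rational inequality certifies the cuprate
  side on a whole `t_pp′`-segment × energy window (the hypothesis of the two-virtual-corner rule of §B.86 on its upper slab).

Sources: three-band model [HybertsenSchluterChristensen1989, Eq. (1)]; contour form [AndersenEtAl1995, §6]; arithmetic [folklore].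
-/

noncomputable section

namespace Summit.Ventures.CertifiedManyBodySolver.Downfold.Emery

open Real Set

/-! ## §1 The fixed-energy `t_pp′` comparison, non-strict regime -/

/-- At a common energy `E ≥ 0` in the sheet regime `c′E ≤ t_pd²` (`Δ + E ≥ 0`, `t_pd ≠ 0`, `0 ≤ c ≤ c′ ≤ t_pp`, `t_pp > 0`):
`fsRatio(c′; E) ≤ fsRatio(c; E)`. [folklore] -/
theorem fsRatio_anti_tppP_at {Δ a b c c' E : ℝ} (ha : a ≠ 0) (hb : 0 < b) (hc : 0 ≤ c) (hcc : c ≤ c') (hcb : c' ≤ b) (hE : 0 ≤ E)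
    (hΔE : 0 ≤ Δ + E) (hreg : c' * E ≤ a ^ 2) :
    fsRatio Δ a b c' E ≤ fsRatio Δ a b c E := by
  have ha2 : 0 < a ^ 2 := by positivity
  have hc' : 0 ≤ c' := hc.trans hcc
  have hN1 : 0 < fsN a b c' E := by
    unfold fsN
    have : 0 ≤ b ^ 2 - c' ^ 2 := by nlinarith
    have : 0 < 2 * a ^ 2 * (c' + b) := by positivity
    nlinarith
  have hN2 : 0 < fsN a b c E := by
    unfold fsN
    have : 0 ≤ b ^ 2 - c ^ 2 := by nlinarith
    have : 0 < 2 * a ^ 2 * (c + b) := by positivity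
    nlinarith
  have hD1 : 0 ≤ fsD Δ a c' E := by unfold fsD; exact mul_nonneg hΔE (by linarith)
  have hD2 : 0 ≤ fsD Δ a c E := by unfold fsD; exact mul_nonneg hΔE (by nlinarith)
  -- N is non-decreasing in c (regime), D non-increasing
  have hNN : fsN a b c E ≤ fsN a b c' E := by
    rw [fsN_eq_mul, fsN_eq_mul]
    have hkey : (c' + b) * (2 * a ^ 2 + E * (b - c')) - (c + b) * (2 * a ^ 2 + E * (b - c)) = (c' - c) * (2 * a ^ 2 - E * (c + c')) := by ring
    have : 0 ≤ (c' - c) * (2 * a ^ 2 - E * (c + c')) := mul_nonneg (by linarith) (by nlinarith)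
    linarith
  have hDD : fsD Δ a c' E ≤ fsD Δ a c E := by
    unfold fsD; exact mul_le_mul_of_nonneg_left (by nlinarith) hΔE
  unfold fsRatio
  exact negRatio_le_of_cross hN1 hN2 hD1 hD2
    (calc fsN a b c E * fsD Δ a c' E ≤ fsN a b c' E * fsD Δ a c' E := mul_le_mul_of_nonneg_right hNN hD1
      _ ≤ fsN a b c' E * fsD Δ a c E := mul_le_mul_of_nonneg_left hDD hN1.le)

/-- At a common row, two energies `0 ≤ E′ ≤ E` in the regime `cE ≤ t_pd²` with `dopingDisc(E′, E) ≤ 0`: `fsRatio(E′) ≤ fsRatio(E)` (the `≤`-regime form of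
`fsRatio_mono_of_dopingDisc_nonpos`). [folklore] -/
theorem fsRatio_mono_energy_of_dopingDisc {Δ a b c E E' : ℝ} (ha : a ≠ 0) (hb : 0 < b) (hc : 0 ≤ c) (hcb : c ≤ b) (hE' : 0 ≤ E') (hEE : E' ≤ E)
    (hΔE : 0 ≤ Δ + E') (hreg : c * E ≤ a ^ 2) (hdisc : dopingDisc Δ a b c E' E ≤ 0) :
    fsRatio Δ a b c E' ≤ fsRatio Δ a b c E := by
  have ha2 : 0 < a ^ 2 := by positivity
  have hbc : 0 ≤ b ^ 2 - c ^ 2 := by nlinarith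
  have hN1 : 0 < fsN a b c E' := by
    unfold fsN
    have : 0 < 2 * a ^ 2 * (c + b) := by positivity
    nlinarith
  have hN2 : 0 < fsN a b c E := by
    unfold fsN
    have : 0 < 2 * a ^ 2 * (c + b) := by positivity
    nlinarith
  have hD1 : 0 ≤ fsD Δ a c E' := by unfold fsD; exact mul_nonneg hΔE (by nlinarith)
  have hD2 : 0 ≤ fsD Δ a c E := by unfold fsD; exact mul_nonneg (by linarith) (by linarith)
  unfold fsRatio
  refine negRatio_le_of_cross hN1 hN2 hD1 hD2 ?_
  have h := cross_eq_sub_mul_dopingDisc Δ a b c E' E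
  have : (E - E') * dopingDisc Δ a b c E' E ≤ 0 := mul_nonpos_of_nonneg_of_nonpos (by linarith) hdisc
  linarith

/-! ## §2 The conditional `t_pp′` lever at fixed doping -/

section Lever

variable {Δ a b c γ ν : ℝ}

/-- **THE CONDITIONAL `t_pp′` LEVER**: `γ ≥ 0`, `c + γ ≤ t_pp`, regime `(c + γ)·ε_F(c; ν) ≤ t_pd²`, and the doping discriminant of the HIGHER-`t_pp′` row
non-positive at the pair `(ε_F(c + γ; ν), ε_F(c; ν))` ⇒ **`R(c + γ) ≤ R(c)`**: raising `t_pp′` makes the fixed-doping `t′/t` more negative. [folklore] -/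
theorem fsRatio_fermiEnergyOf_anti_tppP_of_dopingDisc (hΔ : 0 < Δ) (ha : a ≠ 0) (hb : 0 < b) (hc : 0 ≤ c) (hγ : 0 ≤ γ) (hcb : c + γ ≤ b)
    (hν0 : 0 < ν) (hν1 : ν < 1) (hreg : (c + γ) * fermiEnergyOf Δ a b c ν ≤ a ^ 2)
    (hdisc : dopingDisc Δ a b (c + γ) (fermiEnergyOf Δ a b (c + γ) ν) (fermiEnergyOf Δ a b c ν) ≤ 0) :
    fsRatio Δ a b (c + γ) (fermiEnergyOf Δ a b (c + γ) ν) ≤ fsRatio Δ a b c (fermiEnergyOf Δ a b c ν) := by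
  set E := fermiEnergyOf Δ a b c ν with hE
  set E' := fermiEnergyOf Δ a b (c + γ) ν with hE'
  have hcγ : 0 ≤ c + γ := by linarith
  obtain ⟨e1, -, he1⟩ := exists_fermiEnergy_of_mem_Ioo hΔ ha hc hb.le hν0 hν1
  obtain ⟨e2, -, he2⟩ := exists_fermiEnergy_of_mem_Ioo hΔ ha hcγ hb.le hν0 hν1
  have hEE : E' ≤ E := fermiEnergyOf_anti_tppP hΔ ha hc hb.le hγ hν0 hν1 ⟨e1, he1⟩ ⟨e2, he2⟩
  have hE'0 : 0 < E' := fermiEnergyOf_pos hΔ ha hcγ hb.le hν0 hν1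
  -- step 1: energy channel at the row c + γ
  have s1 : fsRatio Δ a b (c + γ) E' ≤ fsRatio Δ a b (c + γ) E :=
    fsRatio_mono_energy_of_dopingDisc ha hb hcγ hcb hE'0.le hEE (by linarith) hreg hdisc
  -- step 2: fixed-energy t_pp′ channel at E
  have s2 : fsRatio Δ a b (c + γ) E ≤ fsRatio Δ a b c E :=
    fsRatio_anti_tppP_at ha hb hc (by linarith) hcb (by linarith) (by linarith) hreg
  exact s1.trans s2

/-- **CORNER FORM**: with a bracket `e₁ ≤ ε_F(c + γ; ν)`, `ε_F(c; ν) ≤ e₂` and `dopingDisc(c + γ; ·, ·) ≤ 0` at the four corners of `[e₁, e₂]²`, the lever holds.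
[folklore] -/
theorem fsRatio_fermiEnergyOf_anti_tppP_of_corners {e₁ e₂ : ℝ} (hΔ : 0 < Δ) (ha : a ≠ 0) (hb : 0 < b) (hc : 0 ≤ c) (hγ : 0 ≤ γ) (hcb : c + γ ≤ b)
    (hν0 : 0 < ν) (hν1 : ν < 1) (hreg : (c + γ) * fermiEnergyOf Δ a b c ν ≤ a ^ 2)
    (he₁ : e₁ ≤ fermiEnergyOf Δ a b (c + γ) ν) (he₂ : fermiEnergyOf Δ a b c ν ≤ e₂)
    (haa : dopingDisc Δ a b (c + γ) e₁ e₁ ≤ 0) (hab : dopingDisc Δ a b (c + γ) e₁ e₂ ≤ 0)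
    (hba : dopingDisc Δ a b (c + γ) e₂ e₁ ≤ 0) (hbb : dopingDisc Δ a b (c + γ) e₂ e₂ ≤ 0) :
    fsRatio Δ a b (c + γ) (fermiEnergyOf Δ a b (c + γ) ν) ≤ fsRatio Δ a b c (fermiEnergyOf Δ a b c ν) := by
  have hcγ : 0 ≤ c + γ := by linarith
  obtain ⟨f1, -, hf1⟩ := exists_fermiEnergy_of_mem_Ioo hΔ ha hc hb.le hν0 hν1
  obtain ⟨f2, -, hf2⟩ := exists_fermiEnergy_of_mem_Ioo hΔ ha hcγ hb.le hν0 hν1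
  have hEE : fermiEnergyOf Δ a b (c + γ) ν ≤ fermiEnergyOf Δ a b c ν :=
    fermiEnergyOf_anti_tppP hΔ ha hc hb.le hγ hν0 hν1 ⟨f1, hf1⟩ ⟨f2, hf2⟩
  refine fsRatio_fermiEnergyOf_anti_tppP_of_dopingDisc hΔ ha hb hc hγ hcb hν0 hν1 hreg ?_
  exact dopingDisc_nonpos_of_corners ⟨he₁, hEE.trans he₂⟩ ⟨he₁.trans hEE, he₂⟩ haa hab hba hbb

/-- General-endpoint form: `0 ≤ c ≤ c′ ≤ t_pp`, regime `c′·ε_F(c; ν) ≤ t_pd²`, discriminant of the row `c′` non-positive at `(ε_F(c′), ε_F(c))` ⇒ `R(c′) ≤ R(c)`.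
[folklore] -/
theorem fsRatio_fermiEnergyOf_anti_tppP' {c' : ℝ} (hΔ : 0 < Δ) (ha : a ≠ 0) (hb : 0 < b) (hc : 0 ≤ c) (hcc : c ≤ c') (hcb : c' ≤ b)
    (hν0 : 0 < ν) (hν1 : ν < 1) (hreg : c' * fermiEnergyOf Δ a b c ν ≤ a ^ 2)
    (hdisc : dopingDisc Δ a b c' (fermiEnergyOf Δ a b c' ν) (fermiEnergyOf Δ a b c ν) ≤ 0) :
    fsRatio Δ a b c' (fermiEnergyOf Δ a b c' ν) ≤ fsRatio Δ a b c (fermiEnergyOf Δ a b c ν) := by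
  have h := fsRatio_fermiEnergyOf_anti_tppP_of_dopingDisc (γ := c' - c) hΔ ha hb hc (by linarith) (by linarith) hν0 hν1
    (by rw [show c + (c' - c) = c' by ring]; exact hreg) (by rw [show c + (c' - c) = c' by ring]; exact hdisc)
  rwa [show c + (c' - c) = c' by ring] at h

end Lever

/-! ## §3 The slab bound for the doping discriminant -/

/-- **SLAB BOUND**: for `c ∈ [c₁, c₂]` (`0 ≤ c₁`, `c₂ ≤ t_pp`, `c₂Δ ≤ t_pd²`, `Δ ≥ 0`) and `e₁, e₂ ∈ [0, e]`:
`dopingDisc(Δ, t_pd, t_pp, c; e₁, e₂) ≤ t_pd²·[t_pp²Δ − 2(c₁ + t_pp)(t_pd² − c₂Δ) + 4c₂(c₂ + t_pp)e] + c₂t_pp²e²`. [folklore] -/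
theorem dopingDisc_le_slabBound {Δ a b c c₁ c₂ e e₁ e₂ : ℝ} (hΔ : 0 ≤ Δ) (hb : 0 ≤ b) (hc₁ : 0 ≤ c₁) (hc : c ∈ Icc c₁ c₂) (hcb : c₂ ≤ b)
    (hcap : c₂ * Δ ≤ a ^ 2) (he₁ : e₁ ∈ Icc 0 e) (he₂ : e₂ ∈ Icc 0 e) :
    dopingDisc Δ a b c e₁ e₂ ≤ a ^ 2 * (b ^ 2 * Δ - 2 * (c₁ + b) * (a ^ 2 - c₂ * Δ) + 4 * c₂ * (c₂ + b) * e) + c₂ * b ^ 2 * e ^ 2 := by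
  obtain ⟨hc1, hc2⟩ := hc
  obtain ⟨h1l, h1u⟩ := he₁
  obtain ⟨h2l, h2u⟩ := he₂
  have hc0 : 0 ≤ c := hc₁.trans hc1
  have he0 : 0 ≤ e := h1l.trans h1u
  have ha2 : 0 ≤ a ^ 2 := sq_nonneg a
  unfold dopingDisc
  -- term by term
  have t1 : (b ^ 2 - c ^ 2) * Δ ≤ b ^ 2 * Δ := by nlinarith [sq_nonneg c]
  have t2 : -(2 * (c + b) * (a ^ 2 - c * Δ)) ≤ -(2 * (c₁ + b) * (a ^ 2 - c₂ * Δ)) := by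
    have h1 : 0 ≤ c₁ + b := by linarith
    have h2 : c₁ + b ≤ c + b := by linarith
    have h3 : 0 ≤ a ^ 2 - c₂ * Δ := by linarith
    have h4 : a ^ 2 - c₂ * Δ ≤ a ^ 2 - c * Δ := by nlinarith
    nlinarith [mul_le_mul h2 h4 h3 (by linarith)]
  have t3 : 2 * c * (c + b) * (e₁ + e₂) ≤ 4 * c₂ * (c₂ + b) * e := by
    have h1 : c * (c + b) ≤ c₂ * (c₂ + b) := by nlinarith
    have h2 : 0 ≤ c * (c + b) := by positivity
    have h3 : e₁ + e₂ ≤ 2 * e := by linarith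
    nlinarith [mul_le_mul h1 h3 (by linarith) (by nlinarith)]
  have t4 : c * (b ^ 2 - c ^ 2) * (e₁ * e₂) ≤ c₂ * b ^ 2 * e ^ 2 := by
    have h1 : c * (b ^ 2 - c ^ 2) ≤ c₂ * b ^ 2 := by nlinarith [sq_nonneg c, sq_nonneg b, mul_nonneg hc0 (sq_nonneg c)]
    have h2 : 0 ≤ e₁ * e₂ := mul_nonneg h1l h2l
    have h3 : e₁ * e₂ ≤ e ^ 2 := by nlinarith [mul_le_mul h1u h2u h2l he0]
    have h4 : 0 ≤ c * (b ^ 2 - c ^ 2) := mul_nonneg hc0 (by nlinarith)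
    calc c * (b ^ 2 - c ^ 2) * (e₁ * e₂) ≤ c * (b ^ 2 - c ^ 2) * e ^ 2 := mul_le_mul_of_nonneg_left h3 h4
      _ ≤ c₂ * b ^ 2 * e ^ 2 := mul_le_mul_of_nonneg_right h1 (sq_nonneg e)
  have tsum : (b ^ 2 - c ^ 2) * Δ - 2 * (c + b) * (a ^ 2 - c * Δ) + 2 * c * (c + b) * (e₁ + e₂) ≤
      b ^ 2 * Δ - 2 * (c₁ + b) * (a ^ 2 - c₂ * Δ) + 4 * c₂ * (c₂ + b) * e := by linarith
  nlinarith [mul_le_mul_of_nonneg_left tsum ha2]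

/-- **`dopingDisc ≤ 0` ON A SLAB from one rational inequality**: if the slab bound is `≤ 0` then `dopingDisc(c; e₁, e₂) ≤ 0` for every `c ∈ [c₁, c₂]` and
all `e₁, e₂ ∈ [0, e]`. [folklore] -/
theorem dopingDisc_nonpos_on_slab {Δ a b c c₁ c₂ e e₁ e₂ : ℝ} (hΔ : 0 ≤ Δ) (hb : 0 ≤ b) (hc₁ : 0 ≤ c₁) (hc : c ∈ Icc c₁ c₂) (hcb : c₂ ≤ b)
    (hcap : c₂ * Δ ≤ a ^ 2) (he₁ : e₁ ∈ Icc 0 e) (he₂ : e₂ ∈ Icc 0 e)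
    (hslab : a ^ 2 * (b ^ 2 * Δ - 2 * (c₁ + b) * (a ^ 2 - c₂ * Δ) + 4 * c₂ * (c₂ + b) * e) + c₂ * b ^ 2 * e ^ 2 ≤ 0) :
    dopingDisc Δ a b c e₁ e₂ ≤ 0 :=
  (dopingDisc_le_slabBound hΔ hb hc₁ hc hcb hcap he₁ he₂).trans hslab

end Summit.Ventures.CertifiedManyBodySolver.Downfold.Emery
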